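import Summits.Ventures.HodgeRepro2.A2PrimitiveHodge
import Summits.Ventures.HodgeRepro2.A2TheoremAClassModel

/-!
# A2TheoremAClassPrimitive — the primitive part of Theorem A's class is a primitive `(2,2)`-class,
and (N) sees exactly it

Tier-4 annex of sub-claim A2 (seat p6, cell pub-hodge-repro2); §8(d): uses an L-value-free
non-vanishing device: NO.

Row 119 records Theorem A's class `y = z ⋆ θ^4` of the twelve planes and row 116 / 119 that the
Weil projection `p_W` sees only its primitive part.  Row 137 adds the bidegree: for a surface class
`z` of bidegree `(10,10)` the primitive part of `y` lies in the `4212`-dimensional space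
`P^{2,2} = ker Λ ∩ hgrading 2 2` (`theoremA_primPart_mem_hprim`), and the non-vanishing
criterion (N) — `p_W(y) ≠ 0` — is a statement about that primitive `(2,2)`-class
(`weilProjModel_class_eq_weilProjModel_primPart`).

What stays prose: the identification of the model with `H^*(B, ℂ)` (A0.3); not on the N1 chain.
-/

namespace Summit.Ventures.HodgeRepro2.A2TheoremAClassPrimitive

open WeilPlanes WeilIntegral WeilCoproduct A2PontryaginModel A2HodgeTypeModel A2LefschetzSplitting
  A2PrimitiveHodge

/-- `4 ≤ 12`. -/
theorem four_le_twelve : 4 ≤ Fintype.card A2TwelvePlanes.ι₁₂ := by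
  rw [A2TwelvePlanes.card_twelve]; norm_num

/-- Theorem A's class `y = z ⋆ θ^4` of a `(10,10)`-class `z` is a `(2,2)`-class (row 121). -/
theorem theoremA_class_mem_two_two {c : A2TwelvePlanes.ι₁₂ → ℂ} (hc : ∀ p, c p ≠ 0)
    {z : A A2TwelvePlanes.ι₁₂} (hz : z ∈ hgrading 10 10) :
    pontryagin z (theta c ^ 4) ∈ hgrading 2 2 :=
  pontryagin_theta_pow_four_mem_two_two hc hz

/-- THE PRIMITIVE PART OF THEOREM A's CLASS IS A PRIMITIVE `(2,2)`-CLASS: it lies in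
`P^{2,2} = ker Λ ∩ hgrading 2 2` (dimension `4212`, row 137). -/
theorem theoremA_primPart_mem_hprim {c : A2TwelvePlanes.ι₁₂ → ℂ} (hc : ∀ p, c p ≠ 0)
    {z : A A2TwelvePlanes.ι₁₂} (hz : z ∈ hgrading 10 10) :
    primPart c hc four_le_twelve
        (A2HodgeBigrading.hgrading_le_grading 2 2 (theoremA_class_mem_two_two hc hz)) ∈
      hprim c 2 2 := by
  rw [mem_hprim]
  exact ⟨lam_primPart c hc _ _,
    (primPart_mem_hgrading c hc (by norm_num) (by norm_num) four_le_twelve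
      (theoremA_class_mem_two_two hc hz)).1⟩

/-- (N) SEES EXACTLY THE PRIMITIVE `(2,2)`-PART: `p_W(y) = p_W(primPart y)` (row 116's
`weilProjModel_eq_primPart` on Theorem A's class). -/
theorem weilProjModel_class_eq_weilProjModel_primPart {c : A2TwelvePlanes.ι₁₂ → ℂ}
    (hc : ∀ p, c p ≠ 0) {z : A A2TwelvePlanes.ι₁₂} (hz : z ∈ hgrading 10 10)
    (W : Finset (Finset A2TwelvePlanes.ι₁₂ × Bool)) :
    A2WeilProjection.weilProjModel W (pontryagin z (theta c ^ 4)) =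
      A2WeilProjection.weilProjModel W (primPart c hc four_le_twelve
        (A2HodgeBigrading.hgrading_le_grading 2 2 (theoremA_class_mem_two_two hc hz))) :=
  A2PrimitivePart.weilProjModel_eq_primPart hc four_le_twelve _ W

end Summit.Ventures.HodgeRepro2.A2TheoremAClassPrimitive
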